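import Summits.CriticalPhenomena.PercolationContinuityZ3.Theorems.PercNearOneGluingNoHeavyQuantReplicateBinomial
import HarnessLib

/-!
# QUANT lane R8, T-DEC: CONVOLUTION POWERS OF THE GLUED SUB-FOREST LAW — `(δ_A ∗ gate δ_B s)^{∗n} = δ_{nA} ∗ Bin(n, s)·B`:
# `cpow (A+B) (slice δ_A B s) n h = Σ_{i ≤ n} C(n,i) sⁱ(1−s)^{n−i}·[h = nA + iB]` — the atoms of the glued lines `(R^A[q](R^B[s]))^k` and of their
# residual, k-generally (arm-1 gen 49, architect)

builds on p205010 (kernel theorem, internal audit signed; external expert review pending)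

Support file (`--supports stmt-CriticalPhenomena-4575`), QUANT lane seat prim-quant-arm-1 (gen 49, architect), rung R8 of
`run/shared/lean/prim/quant/LADDER.md`; memo `run/shared/lean/prim/quant/prim-quant-arm-1-g49/ARCH-G49.md` §8.  Theorems only, standard axioms, no sorries.
Completes the k-general handles of `…QuantReplicateBinomial` / `…QuantReplicateTilt` (`flaw_replicate_binomial`, `resid_replicate_tilt`: the forest law and the
residual of `k` identical siblings as binomial mixtures of the convolution powers `cpow M ρ n = ρ^{∗n}`) for the lane's glued siblings `R^A[q](R^B[s])`
(`gluedSib`, `…QuantGluedForestSDEC`; sub-forest law `slice δ_A B s = δ_A ∗ gate δ_B s`).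

* `cpow_succ_glued`: `ρ^{∗(n+1)} = slice (slice ρ^{∗n} A 1) B s` (associativity: convolve with the sure `A`-blob, then with the `B`-blob of gate `s`);
* **`cpow_glued_apply`**: `cpow (A+B) (slice δ_A B s) n h = Σ_{i < n+1} C(n,i)·sⁱ·(1−s)^{n−i}·[h = n·A + i·B]` (induction with the Pascal split
  `QuantCensus.DiscountRow.binom_exp_succ`: the `(n+1)`-st pendant blob is on with probability `s`).
With `flaw_replicate_binomial` this is the explicit law of `(R^A[q](R^B[s]))^k` (reached roots `n ~ Bin(k,q)`, pendants `i ~ Bin(n,s)`, atom `nA + iB`), and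
with `resid_replicate_tilt` the explicit residual: the inputs of every symbolic certificate (budget / low-ceiling / half-top, `…QuantBudgetFlow` etc.) for the
glued lines at ANY width.

HONEST STATUS: bookkeeping identities; `ResidDEC`, `SiblingStep`, `GateStepN`, `FarTreeRow` OPEN; RATE class log\* / honest sentence of
`run/shared/lean/prim/quant/README.md` unchanged.  [this work].  Nothing here is cited as a published result.  The gluing rows served
[cite: KozmaNitzan2024, Conjecture 3 (p. 15)]; product measure [cite: Grimmett1999, §1.3 p. 10].
-/

noncomputable section

open scoped BigOperators

namespace Summit.CriticalPhenomena.PercolationContinuityZ3.Theorems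
namespace Quant
namespace LawDec

open Finset

/-- the point mass `δ_K` -/
local notation3 "δ[" K "]" => (fun k : ℕ => if k = (K : ℕ) then (1 : ℝ) else 0)

/-- **one more glued sibling opened**: `ρ^{∗(n+1)} = slice (slice ρ^{∗n} A 1) B s` for `ρ = slice δ_A B s` (`δ_A ∗ gate δ_B s`, associativity of
`lconv`). [this work] -/
theorem cpow_succ_glued (A B n : ℕ) (s : ℝ) (hs0 : 0 ≤ s) (hs1 : s ≤ 1) :
    cpow (A + B) (slice δ[A] B s) (n + 1) = slice (slice (cpow (A + B) (slice δ[A] B s) n) A 1) B s := by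
  set X := cpow (A + B) (slice δ[A] B s) n with hX
  -- law facts of `ρ` and `X`
  have hρ := gluedSib_rho_eq_blobLaw A B s
  have ρ0 : ∀ h, 0 ≤ slice δ[A] B s h := fun h => by
    rw [← hρ]; exact blobLaw_nonneg _ (fun p hp => by
      rcases List.mem_cons.1 hp with rfl | hp
      · exact ⟨hs0, hs1⟩
      · rw [List.mem_singleton] at hp; subst hp; exact ⟨zero_le_one, le_rfl⟩) h
  have ρM : ∀ h, A + B < h → slice δ[A] B s h = 0 := fun h hh => by
    rw [← hρ]; exact blobLaw_eq_zero _ h (by simp [blobTop]; omega)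
  have ρ1 : ∑ h ∈ Finset.range (A + B + 1), slice δ[A] B s h = 1 := by
    have := sum_blobLaw [(B, s), (A, 1)]
    rw [hρ] at this
    simpa [blobTop, Nat.add_comm] using this
  obtain ⟨_, XM, _, _⟩ := cpow_laws (A + B) (slice δ[A] B s) ρ0 ρM ρ1 n
  rw [cpow_succ, ← hX, ← gluedPair_eq_slice s A B, lconv_assoc, ← gate_one δ[A],
    lconv_gate_point_eq_slice (n * (A + B)) A X 1 XM]
  exact lconv_gate_point_eq_slice (n * (A + B) + A) B (slice X A 1) s
    (fun h hh => slice_eq_zero X A 1 (n * (A + B)) XM h hh)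

/-- **THE ATOMS OF THE GLUED POWERS**: `cpow (A+B) (slice δ_A B s) n h = Σ_{i < n+1} C(n,i)·sⁱ(1−s)^{n−i}·[h = nA + iB]` — `n` opened glued siblings carry
`nA` sure relays and `i ~ Bin(n,s)` pendant blobs of size `B`. [this work] -/
theorem cpow_glued_apply (A B : ℕ) (s : ℝ) (hs0 : 0 ≤ s) (hs1 : s ≤ 1) :
    ∀ (n h : ℕ), cpow (A + B) (slice δ[A] B s) n h =
      ∑ i ∈ Finset.range (n + 1), (((Nat.choose n i : ℕ) : ℝ) * s ^ i * (1 - s) ^ (n - i)) * (if h = n * A + i * B then (1 : ℝ) else 0)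
  | 0, h => by simp [cpow]
  | n + 1, h => by
    have ih : ∀ t, cpow (A + B) (slice δ[A] B s) n t =
        ∑ i ∈ Finset.range (n + 1), (((Nat.choose n i : ℕ) : ℝ) * s ^ i * (1 - s) ^ (n - i)) * (if t = n * A + i * B then (1 : ℝ) else 0) :=
      fun t => cpow_glued_apply A B s hs0 hs1 n t
    rw [cpow_succ_glued A B n s hs0 hs1]
    simp only [slice]
    -- the inner sure slice: `[A ≤ t]·X(t − A)`
    have inner : ∀ t : ℕ, ((1 - (1 : ℝ)) * cpow (A + B) (slice δ[A] B s) n t +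
        1 * (if A ≤ t then cpow (A + B) (slice δ[A] B s) n (t - A) else 0))
        = ∑ i ∈ Finset.range (n + 1), (((Nat.choose n i : ℕ) : ℝ) * s ^ i * (1 - s) ^ (n - i)) *
            (if t = (n + 1) * A + i * B then (1 : ℝ) else 0) := by
      intro t
      rw [sub_self, zero_mul, zero_add, one_mul]
      by_cases hAt : A ≤ t
      · rw [if_pos hAt, ih (t - A)]
        refine Finset.sum_congr rfl fun i _ => ?_
        congr 1
        by_cases h1 : t - A = n * A + i * B
        · rw [if_pos h1, if_pos (by rw [Nat.succ_mul]; omega)]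
        · rw [if_neg h1, if_neg (by rw [Nat.succ_mul]; omega)]
      · rw [if_neg hAt]
        symm
        refine Finset.sum_eq_zero fun i _ => ?_
        rw [if_neg (by rw [Nat.succ_mul]; omega), mul_zero]
    rw [inner h]
    have hshift : (if B ≤ h then
        ((1 - (1 : ℝ)) * cpow (A + B) (slice δ[A] B s) n (h - B) +
          1 * (if A ≤ h - B then cpow (A + B) (slice δ[A] B s) n (h - B - A) else 0)) else 0)
        = ∑ i ∈ Finset.range (n + 1), (((Nat.choose n i : ℕ) : ℝ) * s ^ i * (1 - s) ^ (n - i)) *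
            (if h = (n + 1) * A + (i + 1) * B then (1 : ℝ) else 0) := by
      by_cases hBh : B ≤ h
      · rw [if_pos hBh, inner (h - B)]
        refine Finset.sum_congr rfl fun i _ => ?_
        congr 1
        by_cases h1 : h - B = (n + 1) * A + i * B
        · rw [if_pos h1, if_pos (by rw [Nat.succ_mul i B]; omega)]
        · rw [if_neg h1, if_neg (by rw [Nat.succ_mul i B]; omega)]
      · rw [if_neg hBh]
        symm
        refine Finset.sum_eq_zero fun i _ => ?_
        rw [if_neg (by rw [Nat.succ_mul i B]; omega), mul_zero]
    rw [hshift]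
    -- Pascal split on the last pendant
    have pascal := QuantCensus.DiscountRow.binom_exp_succ n s (fun i => if h = (n + 1) * A + i * B then (1 : ℝ) else 0)
    rw [show n + 2 = n + 1 + 1 from rfl] at pascal
    rw [pascal]
    ring


end LawDec
end Quant
end Summit.CriticalPhenomena.PercolationContinuityZ3.Theorems
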